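import Summits.QuantumFields.YangMills.Theorems.UnitScaleTiltProp7TorusGreenPotentialBall
import HarnessLib

/-!
# Route `UnitScaleTilt`, crux K1 «MinimiserStabilityRegPr» (stmt-QuantumFields-19200), route-R E′ path (α′), (E1-b)-cov, row (hK₂-cov) — F3b-cov FILE 2:
# POINTWISE AND `ℓ²` BOUNDS OF THE TORUS-GREEN POTENTIAL OF A VECTOR-VALUED SOURCE ON A BALL (`d = 3`) in terms of the weighted mass
# `S := Σ_{z ∈ B∖{y}} tdist(z,y)²·‖g z‖²` and the pole value `‖g y‖`

Cell `ym3-torus`, width seat `ym3-torus-px7` (gen 3), on px11 g3's (hK₂-cov) LEAD WORDS 2 (L5) (2026-08-28T22:24:11Z), items (iii)(iv)(v); FILE 1 = ✓ `…TorusGreenPotentialBall`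
(p674301: Laplacian (i) + two-centre sum (C2)).  `--supports stmt-QuantumFields-19200`, count-neutral.  THEOREMS ONLY (0 `def`, 0 `sorry`).  YM₃ on T³ is a ladder rung (R3),
not the Clay problem; nothing here claims the stub, the crux, d = 4 or the gap.

WHAT IS PROVED (ns `…Theorems.Prop7TorusGreenPotentialBounds`; `P.d = 3`, `k ≤ m + K`, pole `y ∈ B ⊆ {tdist(·,y) ≤ R}`, `E` a real normed space, `g : Site P 0 → E`,
`w x = Σ_{z∈B} ½G̃(EK x − EK z)•g z`, `S := Σ_{z ∈ B.erase y} (tdist z y)²‖g z‖²`).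
* §1 letters: `norm_potential_le_pole_add_sum` (`‖w x‖ ≤ ½|G̃(EK x − EK y)|‖g y‖ + ½Σ_{z≠y}|G̃(EK x − EK z)|‖g z‖`),
  `sum_abs_mul_norm_le_sqrt` (Cauchy–Schwarz: `Σ_{z≠y}|G̃|‖g z‖ ≤ √A·√S` whenever `Σ_{z≠y} G̃²·tdist(z,y)⁻² ≤ A`).
* §2 ★★★ `norm_potential_le` ((iii): `∃ C_K C₁ ≥ 0, … x ≠ y → tdist x y ≤ R → ‖w x‖ ≤ ½√(C_K∕tdist x y)·√S + ½C₁‖g y‖∕tdist x y`, FILE 1's (C2)),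
  ★ `norm_potential_centre_le` ((iv): `∃ C₁ C₀ ≥ 0, … 1 ≤ R → ‖w y‖ ≤ 12C₁√S + ½C₀‖g y‖`, ✓ `sum_inv_tdist_pow_four_le ≤ 576`),
  ★ `sum_sq_norm_potential_le` ((v): `∃ A₁ A₂ ≥ 0, … 1 ≤ R → Σ_{x∈B}‖w x‖² ≤ A₁·R²·S + A₂·R·‖g y‖²`, ✓ `sum_inv_tdist_le ≤ 128R²`, ✓ `sum_inv_tdist_sq_le ≤ 192R`).
HONEST SCOPE.  Flat lattice letters over FILE 1 and ✓p672925; nothing covariant here.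

References: T. Bałaban, CMP 99 (1985) 75–102 [Balaban1985RegularSpaces] ((1.36) p.82); G. F. Lawler, V. Limic, *Random Walk: A Modern Introduction* (2010), Thm 4.3.1 [LawlerLimic2010].
-/

set_option autoImplicit false

noncomputable section

open scoped BigOperators

namespace Summit.QuantumFields.YangMills.Theorems.Prop7TorusGreenPotentialBounds

open Literature.MathematicalPhysics.QuantumFieldTheory.Balaban1983to89
open Finset
open B3Taylor310LocalRemainder (tdist_comm tdist_self)
open B5Eq117TorusCarriers (EK)
open Literature.Probability.LatticeModels (torusGreen TorusSite)
open Summit.QuantumFields.YangMills.Theorems.Prop7TorusRadialSums (sum_inv_tdist_le sum_inv_tdist_sq_le sum_inv_tdist_pow_four_le)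
open Summit.QuantumFields.YangMills.Theorems.Prop7InterpErrorHarmonicLetters (abs_torusGreen_le_of_eq abs_torusGreen_EK_sub_mul_tdist_le)
open Summit.QuantumFields.YangMills.Theorems.Prop7InterpErrorPinAbstract (tdist_pos_of_ne)
open Summit.QuantumFields.YangMills.Theorems.Prop7TorusGreenPotentialBall (sum_sq_torusGreen_div_sq_le)

variable {P : Params} {k : ℕ} {E : Type*} [NormedAddCommGroup E] [NormedSpace ℝ E]

/-! ## §1 Letters -/

/-- the pole term and the off-pole sum: `‖w x‖ ≤ ½|G̃(EK x − EK y)|·‖g y‖ + ½·Σ_{z ∈ B∖{y}} |G̃(EK x − EK z)|·‖g z‖`. [folklore] -/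
theorem norm_potential_le_pole_add_sum (hk : k ≤ P.m + P.K) (y : Site P 0) (B : Finset (Site P 0)) (hy : y ∈ B)
    (g : Site P 0 → E) (w : Site P 0 → E)
    (hw : ∀ x, w x = ∑ z ∈ B, ((2 : ℝ)⁻¹ * torusGreen (L := P.L ^ k * P.sitesPerDir k) (EK hk x - EK hk z)) • g z) (x : Site P 0) :
    ‖w x‖ ≤ 2⁻¹ * |torusGreen (L := P.L ^ k * P.sitesPerDir k) (EK hk x - EK hk y)| * ‖g y‖
      + 2⁻¹ * ∑ z ∈ B.erase y, |torusGreen (L := P.L ^ k * P.sitesPerDir k) (EK hk x - EK hk z)| * ‖g z‖ := by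
  classical
  rw [hw x, ← Finset.add_sum_erase B _ hy]
  refine (norm_add_le _ _).trans (add_le_add ?_ ?_)
  · rw [norm_smul, Real.norm_eq_abs, abs_mul, abs_of_pos (by norm_num : (0:ℝ) < 2⁻¹)]
  · refine (norm_sum_le _ _).trans (le_of_eq ?_)
    rw [Finset.mul_sum]
    refine Finset.sum_congr rfl fun z _ => ?_
    rw [norm_smul, Real.norm_eq_abs, abs_mul, abs_of_pos (by norm_num : (0:ℝ) < 2⁻¹), mul_assoc]

omit [NormedSpace ℝ E] in
/-- Cauchy–Schwarz for the off-pole sum: if `Σ_{z ∈ B∖{y}} G̃(EK x − EK z)²·tdist(z,y)⁻² ≤ A` then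
`Σ_{z ∈ B∖{y}} |G̃(EK x − EK z)|·‖g z‖ ≤ √A·√(Σ_{z ∈ B∖{y}} tdist(z,y)²‖g z‖²)`. [folklore] -/
theorem sum_abs_mul_norm_le_sqrt (hk : k ≤ P.m + P.K) (y x : Site P 0) (B : Finset (Site P 0)) (g : Site P 0 → E) {A : ℝ}
    (hA : ∑ z ∈ B.erase y, (torusGreen (L := P.L ^ k * P.sitesPerDir k) (EK hk x - EK hk z)) ^ 2 * ((((Site.tdist z y : ℕ) : ℝ)) ^ 2)⁻¹ ≤ A) :
    ∑ z ∈ B.erase y, |torusGreen (L := P.L ^ k * P.sitesPerDir k) (EK hk x - EK hk z)| * ‖g z‖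
      ≤ Real.sqrt A * Real.sqrt (∑ z ∈ B.erase y, ((Site.tdist z y : ℕ) : ℝ) ^ 2 * ‖g z‖ ^ 2) := by
  classical
  set G : Site P 0 → ℝ := fun z => torusGreen (L := P.L ^ k * P.sitesPerDir k) (EK hk x - EK hk z) with hGdef
  have hterm : ∀ z ∈ B.erase y, |G z| * ‖g z‖
      = (|G z| * (((Site.tdist z y : ℕ) : ℝ))⁻¹) * ((((Site.tdist z y : ℕ) : ℝ)) * ‖g z‖) := by
    intro z hz
    have ht0 : (((Site.tdist z y : ℕ) : ℝ)) ≠ 0 := by exact_mod_cast (tdist_pos_of_ne (Finset.mem_erase.1 hz).1).ne'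
    field_simp
  have e0 : ∑ z ∈ B.erase y, |torusGreen (L := P.L ^ k * P.sitesPerDir k) (EK hk x - EK hk z)| * ‖g z‖ = ∑ z ∈ B.erase y, |G z| * ‖g z‖ := rfl
  rw [e0, Finset.sum_congr rfl hterm]
  refine (Real.sum_mul_le_sqrt_mul_sqrt _ _ _).trans ?_
  have e1 : ∑ z ∈ B.erase y, (|G z| * (((Site.tdist z y : ℕ) : ℝ))⁻¹) ^ 2
      = ∑ z ∈ B.erase y, G z ^ 2 * ((((Site.tdist z y : ℕ) : ℝ)) ^ 2)⁻¹ :=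
    Finset.sum_congr rfl fun z _ => by rw [mul_pow, sq_abs, inv_pow]
  have e2 : ∑ z ∈ B.erase y, ((((Site.tdist z y : ℕ) : ℝ)) * ‖g z‖) ^ 2 = ∑ z ∈ B.erase y, ((Site.tdist z y : ℕ) : ℝ) ^ 2 * ‖g z‖ ^ 2 :=
    Finset.sum_congr rfl fun z _ => by rw [mul_pow]
  rw [e1, e2]
  exact mul_le_mul_of_nonneg_right (Real.sqrt_le_sqrt (by rw [hGdef]; exact hA)) (Real.sqrt_nonneg _)

/-! ## §2 The bounds -/

/-- ★★★ **(iii) THE POTENTIAL OFF THE POLE**: there are absolute `C_K, C₁ ≥ 0` such that for every pole `y ∈ B ⊆ {tdist(·,y) ≤ R}`, every source `g`,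
`w x = Σ_{z∈B} ½G̃(EK x − EK z)•g z`, and every `x ≠ y` with `tdist x y ≤ R`:
`‖w x‖ ≤ ½·√(C_K ∕ tdist x y)·√(Σ_{z ∈ B.erase y} tdist(z,y)²‖g z‖²) + ½·C₁·‖g y‖ ∕ tdist x y` (FILE 1's (C2) + Cauchy–Schwarz; the pole term by the cone row).
[cite: Balaban1985RegularSpaces, (1.36) p.82; LawlerLimic2010, Thm 4.3.1] -/
theorem norm_potential_le : ∃ CK C₁ : ℝ, 0 ≤ CK ∧ 0 ≤ C₁ ∧
    ∀ (P : Params) (_ : P.d = 3) (k : ℕ) (hk : k ≤ P.m + P.K) (y : Site P 0) (B : Finset (Site P 0)) (R : ℕ)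
      (_ : ∀ z ∈ B, Site.tdist z y ≤ R) (_ : y ∈ B) (g : Site P 0 → E) (w : Site P 0 → E)
      (_ : ∀ x, w x = ∑ z ∈ B, ((2 : ℝ)⁻¹ * torusGreen (L := P.L ^ k * P.sitesPerDir k) (EK hk x - EK hk z)) • g z)
      (x : Site P 0), x ≠ y → Site.tdist x y ≤ R →
      ‖w x‖ ≤ 2⁻¹ * Real.sqrt (CK / (Site.tdist x y : ℝ)) * Real.sqrt (∑ z ∈ B.erase y, ((Site.tdist z y : ℕ) : ℝ) ^ 2 * ‖g z‖ ^ 2)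
        + 2⁻¹ * C₁ * ‖g y‖ / (Site.tdist x y : ℝ) := by
  obtain ⟨CK, hCK, hC2⟩ := sum_sq_torusGreen_div_sq_le
  obtain ⟨C₁, hC₁, hG1⟩ := abs_torusGreen_EK_sub_mul_tdist_le
  refine ⟨CK, C₁, hCK, hC₁, ?_⟩
  intro P hd k hk y B R hB hy g w hw x hxy hxR
  have ht0 : (0 : ℝ) < Site.tdist x y := by exact_mod_cast tdist_pos_of_ne hxy
  have hpole : |torusGreen (L := P.L ^ k * P.sitesPerDir k) (EK hk x - EK hk y)| ≤ C₁ / (Site.tdist x y : ℝ) := by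
    rw [le_div_iff₀ ht0]; exact hG1 P hd k hk x y (Ne.symm hxy)
  have hoff := sum_abs_mul_norm_le_sqrt hk y x B g (hC2 P hd k hk y x B R hB hxy hxR)
  calc ‖w x‖ ≤ _ := norm_potential_le_pole_add_sum hk y B hy g w hw x
    _ ≤ 2⁻¹ * (C₁ / (Site.tdist x y : ℝ)) * ‖g y‖
        + 2⁻¹ * (Real.sqrt (CK / (Site.tdist x y : ℝ)) * Real.sqrt (∑ z ∈ B.erase y, ((Site.tdist z y : ℕ) : ℝ) ^ 2 * ‖g z‖ ^ 2)) :=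
        add_le_add (mul_le_mul_of_nonneg_right (mul_le_mul_of_nonneg_left hpole (by norm_num)) (norm_nonneg _))
          (mul_le_mul_of_nonneg_left hoff (by norm_num))
    _ = _ := by ring

/-- ★ **(iv) THE POTENTIAL AT THE POLE**: there are absolute `C₁, C₀ ≥ 0` such that (same data, `1 ≤ R`)
`‖w y‖ ≤ 12·C₁·√(Σ_{z ∈ B.erase y} tdist(z,y)²‖g z‖²) + ½·C₀·‖g y‖` (`|G̃(EK y − EK z)| ≤ C₁∕tdist`, `Σ_{z≠y} tdist⁻⁴ ≤ 576`, `|G̃ 0| ≤ C₀`).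
[cite: Balaban1985RegularSpaces, (1.36) p.82; LawlerLimic2010, Thm 4.3.1] -/
theorem norm_potential_centre_le : ∃ C₁ C₀ : ℝ, 0 ≤ C₁ ∧ 0 ≤ C₀ ∧
    ∀ (P : Params) (_ : P.d = 3) (k : ℕ) (hk : k ≤ P.m + P.K) (y : Site P 0) (B : Finset (Site P 0)) (R : ℕ) (_ : 1 ≤ R)
      (_ : ∀ z ∈ B, Site.tdist z y ≤ R) (_ : y ∈ B) (g : Site P 0 → E) (w : Site P 0 → E)
      (_ : ∀ x, w x = ∑ z ∈ B, ((2 : ℝ)⁻¹ * torusGreen (L := P.L ^ k * P.sitesPerDir k) (EK hk x - EK hk z)) • g z),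
      ‖w y‖ ≤ 12 * C₁ * Real.sqrt (∑ z ∈ B.erase y, ((Site.tdist z y : ℕ) : ℝ) ^ 2 * ‖g z‖ ^ 2) + 2⁻¹ * C₀ * ‖g y‖ := by
  obtain ⟨C₁, hC₁, hG1⟩ := abs_torusGreen_EK_sub_mul_tdist_le
  obtain ⟨C₀, hC₀, hG0⟩ := abs_torusGreen_le_of_eq
  refine ⟨C₁, C₀, hC₁, hC₀, ?_⟩
  intro P hd k hk y B R hR hB hy g w hw
  haveI : NeZero (P.L ^ k * P.sitesPerDir k) := ⟨mul_ne_zero (pow_ne_zero _ P.L_pos.ne') (P.sitesPerDir_ne_zero k)⟩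
  have hpole : |torusGreen (L := P.L ^ k * P.sitesPerDir k) (EK hk y - EK hk y)| ≤ C₀ := by
    rw [sub_self]; exact hG0 hd _ _
  have hA : ∑ z ∈ B.erase y, (torusGreen (L := P.L ^ k * P.sitesPerDir k) (EK hk y - EK hk z)) ^ 2 * ((((Site.tdist z y : ℕ) : ℝ)) ^ 2)⁻¹
      ≤ (24 * C₁) ^ 2 := by
    have hpt : ∀ z ∈ B.erase y, (torusGreen (L := P.L ^ k * P.sitesPerDir k) (EK hk y - EK hk z)) ^ 2 * ((((Site.tdist z y : ℕ) : ℝ)) ^ 2)⁻¹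
        ≤ C₁ ^ 2 * ((((Site.tdist z y : ℕ) : ℝ)) ^ 4)⁻¹ := by
      intro z hz
      have hzy : z ≠ y := (Finset.mem_erase.1 hz).1
      have ht0 : (0 : ℝ) < Site.tdist z y := by exact_mod_cast tdist_pos_of_ne hzy
      have h1 := hG1 P hd k hk y z hzy
      rw [tdist_comm y z] at h1
      have h2 : (torusGreen (L := P.L ^ k * P.sitesPerDir k) (EK hk y - EK hk z)) ^ 2 * (Site.tdist z y : ℝ) ^ 2 ≤ C₁ ^ 2 := by
        rw [← sq_abs, ← mul_pow]; exact pow_le_pow_left₀ (by positivity) h1 2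
      have hG : (torusGreen (L := P.L ^ k * P.sitesPerDir k) (EK hk y - EK hk z)) ^ 2 ≤ C₁ ^ 2 / (Site.tdist z y : ℝ) ^ 2 := by
        rw [le_div_iff₀ (by positivity)]; exact h2
      calc (torusGreen (L := P.L ^ k * P.sitesPerDir k) (EK hk y - EK hk z)) ^ 2 * ((((Site.tdist z y : ℕ) : ℝ)) ^ 2)⁻¹
          ≤ (C₁ ^ 2 / (Site.tdist z y : ℝ) ^ 2) * ((((Site.tdist z y : ℕ) : ℝ)) ^ 2)⁻¹ := mul_le_mul_of_nonneg_right hG (by positivity)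
        _ = C₁ ^ 2 * ((((Site.tdist z y : ℕ) : ℝ)) ^ 4)⁻¹ := by field_simp
    have hrad := sum_inv_tdist_pow_four_le hd (B.erase y) y (M := 1) (N := R) le_rfl hR
      (fun z hz => ⟨tdist_pos_of_ne (Finset.mem_erase.1 hz).1, hB z (Finset.mem_erase.1 hz).2⟩)
    calc ∑ z ∈ B.erase y, (torusGreen (L := P.L ^ k * P.sitesPerDir k) (EK hk y - EK hk z)) ^ 2 * ((((Site.tdist z y : ℕ) : ℝ)) ^ 2)⁻¹
        ≤ ∑ z ∈ B.erase y, C₁ ^ 2 * ((((Site.tdist z y : ℕ) : ℝ)) ^ 4)⁻¹ := Finset.sum_le_sum hpt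
      _ = C₁ ^ 2 * ∑ z ∈ B.erase y, ((((Site.tdist z y : ℕ) : ℝ)) ^ 4)⁻¹ := by rw [Finset.mul_sum]
      _ ≤ C₁ ^ 2 * 576 := mul_le_mul_of_nonneg_left (hrad.trans (by norm_num)) (sq_nonneg _)
      _ = (24 * C₁) ^ 2 := by ring
  have hoff := sum_abs_mul_norm_le_sqrt hk y y B g hA
  rw [Real.sqrt_sq (by positivity)] at hoff
  calc ‖w y‖ ≤ _ := norm_potential_le_pole_add_sum hk y B hy g w hw y
    _ ≤ 2⁻¹ * C₀ * ‖g y‖ + 2⁻¹ * (24 * C₁ * Real.sqrt (∑ z ∈ B.erase y, ((Site.tdist z y : ℕ) : ℝ) ^ 2 * ‖g z‖ ^ 2)) :=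
        add_le_add (mul_le_mul_of_nonneg_right (mul_le_mul_of_nonneg_left hpole (by norm_num)) (norm_nonneg _))
          (mul_le_mul_of_nonneg_left hoff (by norm_num))
    _ = _ := by ring

/-- ★ **(v) THE `ℓ²` MASS OF THE POTENTIAL ON THE BALL**: there are absolute `A₁, A₂ ≥ 0` such that (same data, `1 ≤ R`)
`Σ_{x ∈ B} ‖w x‖² ≤ A₁·R²·Σ_{z ∈ B.erase y} tdist(z,y)²‖g z‖² + A₂·R·‖g y‖²` ((iii)² summed with ✓ `sum_inv_tdist_le ≤ 128R²`, ✓ `sum_inv_tdist_sq_le ≤ 192R`; (iv)² at the pole).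
[cite: Balaban1985RegularSpaces, (1.36) p.82; LawlerLimic2010, Thm 4.3.1] -/
theorem sum_sq_norm_potential_le : ∃ A₁ A₂ : ℝ, 0 ≤ A₁ ∧ 0 ≤ A₂ ∧
    ∀ (P : Params) (_ : P.d = 3) (k : ℕ) (hk : k ≤ P.m + P.K) (y : Site P 0) (B : Finset (Site P 0)) (R : ℕ) (_ : 1 ≤ R)
      (_ : ∀ z ∈ B, Site.tdist z y ≤ R) (_ : y ∈ B) (g : Site P 0 → E) (w : Site P 0 → E)
      (_ : ∀ x, w x = ∑ z ∈ B, ((2 : ℝ)⁻¹ * torusGreen (L := P.L ^ k * P.sitesPerDir k) (EK hk x - EK hk z)) • g z),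
      ∑ x ∈ B, ‖w x‖ ^ 2 ≤ A₁ * (R : ℝ) ^ 2 * ∑ z ∈ B.erase y, ((Site.tdist z y : ℕ) : ℝ) ^ 2 * ‖g z‖ ^ 2 + A₂ * R * ‖g y‖ ^ 2 := by
  obtain ⟨CK, C₁, hCK, hC₁, hiii⟩ := norm_potential_le (E := E)
  obtain ⟨C₁', C₀, hC₁', hC₀, hiv⟩ := norm_potential_centre_le (E := E)
  refine ⟨64 * CK + 288 * C₁' ^ 2, 96 * C₁ ^ 2 + C₀ ^ 2 / 2, by positivity, by positivity, ?_⟩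
  intro P hd k hk y B R hR hB hy g w hw
  classical
  have hR1 : (1 : ℝ) ≤ R := by exact_mod_cast hR
  have hR0 : (0 : ℝ) < R := by linarith
  set S : ℝ := ∑ z ∈ B.erase y, ((Site.tdist z y : ℕ) : ℝ) ^ 2 * ‖g z‖ ^ 2 with hSdef
  have hS0 : 0 ≤ S := Finset.sum_nonneg fun _ _ => by positivity
  -- off the pole
  have hsqx : ∀ x ∈ B.erase y, ‖w x‖ ^ 2 ≤ 2⁻¹ * CK * S * (((Site.tdist x y : ℕ) : ℝ))⁻¹
      + 2⁻¹ * C₁ ^ 2 * ‖g y‖ ^ 2 * ((((Site.tdist x y : ℕ) : ℝ)) ^ 2)⁻¹ := by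
    intro x hx
    obtain ⟨hxy, hxB⟩ := Finset.mem_erase.1 hx
    have ht0 : (0 : ℝ) < Site.tdist x y := by exact_mod_cast tdist_pos_of_ne hxy
    have h1 := hiii P hd k hk y B R hB hy g w hw x hxy (hB x hxB)
    have hq0 : 0 ≤ CK / (Site.tdist x y : ℝ) := div_nonneg hCK ht0.le
    have ha0 : 0 ≤ 2⁻¹ * Real.sqrt (CK / (Site.tdist x y : ℝ)) * Real.sqrt S :=
      mul_nonneg (mul_nonneg (by norm_num) (Real.sqrt_nonneg _)) (Real.sqrt_nonneg _)
    have hb0 : 0 ≤ 2⁻¹ * C₁ * ‖g y‖ / (Site.tdist x y : ℝ) := div_nonneg (mul_nonneg (mul_nonneg (by norm_num) hC₁) (norm_nonneg _)) ht0.le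
    calc ‖w x‖ ^ 2 ≤ (2⁻¹ * Real.sqrt (CK / (Site.tdist x y : ℝ)) * Real.sqrt S + 2⁻¹ * C₁ * ‖g y‖ / (Site.tdist x y : ℝ)) ^ 2 :=
          pow_le_pow_left₀ (norm_nonneg _) h1 2
      _ ≤ 2 * (2⁻¹ * Real.sqrt (CK / (Site.tdist x y : ℝ)) * Real.sqrt S) ^ 2 + 2 * (2⁻¹ * C₁ * ‖g y‖ / (Site.tdist x y : ℝ)) ^ 2 :=
          by linarith only [sq_nonneg (2⁻¹ * Real.sqrt (CK / (Site.tdist x y : ℝ)) * Real.sqrt S - 2⁻¹ * C₁ * ‖g y‖ / (Site.tdist x y : ℝ)),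
            add_sq (2⁻¹ * Real.sqrt (CK / (Site.tdist x y : ℝ)) * Real.sqrt S) (2⁻¹ * C₁ * ‖g y‖ / (Site.tdist x y : ℝ)),
            sub_sq (2⁻¹ * Real.sqrt (CK / (Site.tdist x y : ℝ)) * Real.sqrt S) (2⁻¹ * C₁ * ‖g y‖ / (Site.tdist x y : ℝ))]
      _ = 2⁻¹ * CK * S * (((Site.tdist x y : ℕ) : ℝ))⁻¹ + 2⁻¹ * C₁ ^ 2 * ‖g y‖ ^ 2 * ((((Site.tdist x y : ℕ) : ℝ)) ^ 2)⁻¹ := by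
          rw [mul_pow, mul_pow, Real.sq_sqrt hq0, Real.sq_sqrt hS0, div_pow]
          field_simp
  -- at the pole
  have hsqy : ‖w y‖ ^ 2 ≤ 288 * C₁' ^ 2 * S + C₀ ^ 2 / 2 * ‖g y‖ ^ 2 := by
    have h1 := hiv P hd k hk y B R hR hB hy g w hw
    calc ‖w y‖ ^ 2 ≤ (12 * C₁' * Real.sqrt S + 2⁻¹ * C₀ * ‖g y‖) ^ 2 := pow_le_pow_left₀ (norm_nonneg _) h1 2
      _ ≤ 2 * (12 * C₁' * Real.sqrt S) ^ 2 + 2 * (2⁻¹ * C₀ * ‖g y‖) ^ 2 := by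
          linarith only [sq_nonneg (12 * C₁' * Real.sqrt S - 2⁻¹ * C₀ * ‖g y‖), add_sq (12 * C₁' * Real.sqrt S) (2⁻¹ * C₀ * ‖g y‖),
            sub_sq (12 * C₁' * Real.sqrt S) (2⁻¹ * C₀ * ‖g y‖)]
      _ = 288 * C₁' ^ 2 * S + C₀ ^ 2 / 2 * ‖g y‖ ^ 2 := by
          rw [mul_pow, mul_pow, Real.sq_sqrt hS0]; ring
  have hmem : ∀ z ∈ B.erase y, 1 ≤ Site.tdist z y ∧ Site.tdist z y ≤ R :=
    fun z hz => ⟨tdist_pos_of_ne (Finset.mem_erase.1 hz).1, hB z (Finset.mem_erase.1 hz).2⟩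
  have hr1 := sum_inv_tdist_le hd (B.erase y) y (M := 1) (N := R) le_rfl hR hmem
  have hr2 := sum_inv_tdist_sq_le hd (B.erase y) y (M := 1) (N := R) le_rfl hR hmem
  rw [← Finset.add_sum_erase B _ hy]
  calc ‖w y‖ ^ 2 + ∑ x ∈ B.erase y, ‖w x‖ ^ 2
      ≤ (288 * C₁' ^ 2 * S + C₀ ^ 2 / 2 * ‖g y‖ ^ 2)
        + ∑ x ∈ B.erase y, (2⁻¹ * CK * S * (((Site.tdist x y : ℕ) : ℝ))⁻¹
            + 2⁻¹ * C₁ ^ 2 * ‖g y‖ ^ 2 * ((((Site.tdist x y : ℕ) : ℝ)) ^ 2)⁻¹) := add_le_add hsqy (Finset.sum_le_sum hsqx)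
    _ = (288 * C₁' ^ 2 * S + C₀ ^ 2 / 2 * ‖g y‖ ^ 2)
        + (2⁻¹ * CK * S * ∑ x ∈ B.erase y, (((Site.tdist x y : ℕ) : ℝ))⁻¹
            + 2⁻¹ * C₁ ^ 2 * ‖g y‖ ^ 2 * ∑ x ∈ B.erase y, ((((Site.tdist x y : ℕ) : ℝ)) ^ 2)⁻¹) := by
        simp only [Finset.sum_add_distrib, ← Finset.mul_sum]
    _ ≤ (288 * C₁' ^ 2 * S + C₀ ^ 2 / 2 * ‖g y‖ ^ 2) + (2⁻¹ * CK * S * (128 * (R : ℝ) ^ 2) + 2⁻¹ * C₁ ^ 2 * ‖g y‖ ^ 2 * (192 * (R : ℝ))) := by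
        refine add_le_add le_rfl (add_le_add ?_ ?_)
        · exact mul_le_mul_of_nonneg_left hr1 (by positivity)
        · exact mul_le_mul_of_nonneg_left hr2 (by positivity)
    _ ≤ (64 * CK + 288 * C₁' ^ 2) * (R : ℝ) ^ 2 * S + (96 * C₁ ^ 2 + C₀ ^ 2 / 2) * R * ‖g y‖ ^ 2 := by
        have h1 : 288 * C₁' ^ 2 * S ≤ 288 * C₁' ^ 2 * (R : ℝ) ^ 2 * S := by
          have : S ≤ (R : ℝ) ^ 2 * S := le_mul_of_one_le_left hS0 (one_le_pow₀ hR1)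
          nlinarith [sq_nonneg C₁']
        have h2 : C₀ ^ 2 / 2 * ‖g y‖ ^ 2 ≤ C₀ ^ 2 / 2 * R * ‖g y‖ ^ 2 := by
          have : ‖g y‖ ^ 2 ≤ (R : ℝ) * ‖g y‖ ^ 2 := le_mul_of_one_le_left (sq_nonneg _) hR1
          nlinarith [sq_nonneg C₀]
        nlinarith [h1, h2]

end Summit.QuantumFields.YangMills.Theorems.Prop7TorusGreenPotentialBounds

end
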